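import Summits.AtomisticToContinuum.BoseEinsteinCondensation.Theorems.BECThomsonPrincipleGDTransferLnssAlgebraDirections

/-!
# Route `BECThomsonPrinciple`, crux `GDTransfer` (stmt-AtomisticToContinuum-9482), line `dyson-dressed-witness`:
# stub `lnssAlgebra` — the LNSS configuration-space algebra (L2), (L3) and `stub_lnssAlgebra`

The registered stub `stub_lnssAlgebra : Sig.stub_lnssAlgebra` (`= LNSSAlgebra`).  For a periodic trial
state `Ψ` (`N = m + 1` bosons) and `n ∈ ℤ³`, with `Λ_n = n̂₀^{-1/2} a_0† a_n` (`lnssLower`),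
`Λ_n† = a_n† a_0 n̂₀^{-1/2}` (`lnssUpper`) and the source pairing `σ_n(g, h) = ∫ conj(g) e_n(x₀) Θ_h`
(`srcPair`, `Θ = P₀ n̂₀^{-1/2}`):
* (L1) `Λ_nΨ`, `Λ_n†Ψ` are directions (part 2, `isDirection_lnssLower/Upper`);
* (L2) `N σ_n(g, Ψ) = ⟨g, Λ_n†Ψ⟩` and `N σ_n(Ψ, g) = ⟨Λ_nΨ, g⟩` for every direction `g`: Bose symmetry
  moves the distinguished particle `0` to any slot `i` (`X ↦ X ∘ (0 i)` preserves `dX|_{cell^N}`,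
  `setIntegral_cellN_comp_perm`), `P₀ n̂₀^{-1/2} = Θ`, and `P_i`, `Q_S`, `n̂₀^{-1/2}` are self-adjoint
  (`integral_conj_mul_rootInv`) with `P_i(conj(e_n(x_i)) ·) = P_i^{(n)}`;
* (L3) `‖Λ_nΨ‖² = n_n(Ψ)`: Pythagoras over the orthogonal `Q_S` (`‖n̂₀^{-1/2}h‖² = Σ_{S≠∅}|S|⁻¹‖Q_S h‖²`,
  `h = Σ_i P_i^{(n)}Ψ`), `Q_S P_i^{(n)}Ψ = 0` for `i ∉ S` (flatness) and `Q_S P_i^{(n)}Ψ = Q_S P_j^{(n)}Ψ`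
  for `i, j ∈ S` (Bose symmetry), so `‖Λ_nΨ‖² = Σ_i Σ_S ‖Q_S P_i^{(n)}Ψ‖² = Σ_i ‖P_i^{(n)}Ψ‖² = N‖P_0^{(n)}Ψ‖²`,
  which is `n_n(Ψ)` by the slice formula `cellOccupation_succ` (`Λ_n†Λ_n = n̂_n`).
All [folklore] (arXiv:1211.2778 §2–3; LSSY2005 §1.2 (1.17) and App. A).
-/

noncomputable section

open MeasureTheory Filter
open scoped ENNReal NNReal ComplexConjugate

namespace Summit.AtomisticToContinuum.BoseEinsteinCondensation.Cruxes.GDTransfer.DysonDressedWitness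

namespace Lnss

open Literature.MathematicalPhysics.QuantumManyBody.BoseGas
open Summit.AtomisticToContinuum.BoseEinsteinCondensation.Theorems.GaussianDominationCan.Negative
open ChordVariation (continuous_modeProj)

variable {m : ℕ} {L : ℝ}

/-! ## Self-adjointness of `n̂₀^{-1/2}` -/

/-- **`n̂₀^{-1/2}` is self-adjoint** on continuous functions (its coefficients `|S|^{-1/2}` are real and
every `Q_S` is self-adjoint). [folklore] -/
theorem integral_conj_mul_rootInv {f g : Config (m + 1) → ℂ} (hf : Continuous f) (hg : Continuous g) :
    ∫ X in cellN (m + 1) L, conj (f X) * rootInv m L g X =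
      ∫ X in cellN (m + 1) L, conj (rootInv m L f X) * g X := by
  have hQf : ∀ S, Continuous (modeProj (m + 1) L S f) := fun S => continuous_modeProj S hf
  have hQg : ∀ S, Continuous (modeProj (m + 1) L S g) := fun S => continuous_modeProj S hg
  have hcf : Continuous fun X => conj (f X) := Complex.continuous_conj.comp hf
  have h1 : ∀ S ∈ (Finset.univ : Finset (Finset (Fin (m + 1)))).filter (fun S => S.Nonempty),
      Integrable (fun X => ((Real.sqrt (S.card : ℝ))⁻¹ : ℂ) *
        (conj (f X) * modeProj (m + 1) L S g X))
        ((volume : Measure (Config (m + 1))).restrict (cellN (m + 1) L)) := fun S _ =>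
    integrableOn_cellN (continuous_const.mul (hcf.mul (hQg S))) L
  have h2 : ∀ S ∈ (Finset.univ : Finset (Finset (Fin (m + 1)))).filter (fun S => S.Nonempty),
      Integrable (fun X => ((Real.sqrt (S.card : ℝ))⁻¹ : ℂ) *
        (conj (modeProj (m + 1) L S f X) * g X))
        ((volume : Measure (Config (m + 1))).restrict (cellN (m + 1) L)) := fun S _ =>
    integrableOn_cellN (continuous_const.mul ((Complex.continuous_conj.comp (hQf S)).mul hg)) L
  unfold rootInv
  calc ∫ X in cellN (m + 1) L, conj (f X) *
        ∑ S ∈ (Finset.univ : Finset (Finset (Fin (m + 1)))).filter (fun S => S.Nonempty),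
          ((Real.sqrt (S.card : ℝ))⁻¹ : ℂ) * modeProj (m + 1) L S g X
      = ∫ X in cellN (m + 1) L,
          ∑ S ∈ (Finset.univ : Finset (Finset (Fin (m + 1)))).filter (fun S => S.Nonempty),
            ((Real.sqrt (S.card : ℝ))⁻¹ : ℂ) * (conj (f X) * modeProj (m + 1) L S g X) := by
        refine integral_congr_ae (Eventually.of_forall fun X => ?_)
        simp only [Finset.mul_sum]
        exact Finset.sum_congr rfl fun S _ => by ring
    _ = ∑ S ∈ (Finset.univ : Finset (Finset (Fin (m + 1)))).filter (fun S => S.Nonempty),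
          ((Real.sqrt (S.card : ℝ))⁻¹ : ℂ) *
            ∫ X in cellN (m + 1) L, conj (modeProj (m + 1) L S f X) * g X := by
        rw [integral_finsetSum _ h1]
        refine Finset.sum_congr rfl fun S _ => ?_
        rw [integral_const_mul, integral_conj_mul_modeProj S hf hg]
    _ = ∫ X in cellN (m + 1) L,
          ∑ S ∈ (Finset.univ : Finset (Finset (Fin (m + 1)))).filter (fun S => S.Nonempty),
            ((Real.sqrt (S.card : ℝ))⁻¹ : ℂ) * (conj (modeProj (m + 1) L S f X) * g X) := by
        rw [integral_finsetSum _ h2]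
        exact Finset.sum_congr rfl fun S _ => (integral_const_mul _ _).symm
    _ = ∫ X in cellN (m + 1) L, conj
          (∑ S ∈ (Finset.univ : Finset (Finset (Fin (m + 1)))).filter (fun S => S.Nonempty),
            ((Real.sqrt (S.card : ℝ))⁻¹ : ℂ) * modeProj (m + 1) L S f X) * g X := by
        refine integral_congr_ae (Eventually.of_forall fun X => ?_)
        simp only [map_sum, map_mul, map_inv₀, Complex.conj_ofReal, Finset.sum_mul]
        exact Finset.sum_congr rfl fun S _ => by ring

/-! ## (L2) The swap `0 ↔ i` and the two pairing identities -/

/-- **Bose symmetry moves the distinguished particle**: for symmetric `f`, `R`,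
`∫ conj(f) e_n(x_i) P_i R = ∫ conj(f) e_n(x_0) P_0 R` (change of variables `X ↦ X ∘ (0 i)`).
[folklore] -/
theorem integral_slot_eq_slot_zero (n : Fin 3 → ℤ) (i : Fin (m + 1)) {f R : Config (m + 1) → ℂ}
    (hf : ∀ (σ : Equiv.Perm (Fin (m + 1))) (X : Config (m + 1)), f (X ∘ σ) = f X)
    (hR : ∀ (σ : Equiv.Perm (Fin (m + 1))) (X : Config (m + 1)), R (X ∘ σ) = R X) :
    ∫ X in cellN (m + 1) L, conj (f X) * (cellWave L n (X i) * cellAvg (m + 1) L i R X) =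
      ∫ X in cellN (m + 1) L, conj (f X) * (cellWave L n (X 0) * cellAvg (m + 1) L 0 R X) := by
  rw [← setIntegral_cellN_comp_perm (Equiv.swap 0 i)
    (fun X => conj (f X) * (cellWave L n (X 0) * cellAvg (m + 1) L 0 R X))]
  refine integral_congr_ae (Eventually.of_forall fun X => ?_)
  simp only [Function.comp_apply, Equiv.swap_apply_left, hf,
    cellAvg_comp_perm_of_symm (Equiv.swap 0 i) 0 hR]

/-- Each slot term of `⟨f, Λ_n† h⟩` is the source pairing: for symmetric `f` and continuous
symmetric `h`, `∫ conj(f) e_n(x_i) P_i n̂₀^{-1/2} h = σ_n(f, h)`. [folklore] -/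
theorem integral_slot_eq_srcPair (hL : 0 < L) (n : Fin 3 → ℤ) (i : Fin (m + 1))
    {f h : Config (m + 1) → ℂ}
    (hf : ∀ (σ : Equiv.Perm (Fin (m + 1))) (X : Config (m + 1)), f (X ∘ σ) = f X)
    (hh : Continuous h)
    (hhs : ∀ (σ : Equiv.Perm (Fin (m + 1))) (X : Config (m + 1)), h (X ∘ σ) = h X) :
    ∫ X in cellN (m + 1) L, conj (f X) *
        (cellWave L n (X i) * cellAvg (m + 1) L i (rootInv m L h) X) = srcPair m L n f h := by
  rw [integral_slot_eq_slot_zero n i hf (fun σ X => rootInv_comp_perm hh hhs σ X)]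
  unfold srcPair
  refine integral_congr_ae (Eventually.of_forall fun X => ?_)
  simp only
  rw [cellAvg_zero_rootInv hL hh, phase_eq_cellWave, mul_assoc]

/-- **(L2, first identity)**: `N σ_n(g, ψ) = ⟨g, Λ_n† ψ⟩` for continuous symmetric `g`, `ψ`.
[folklore] -/
theorem natMul_srcPair_eq_inner_lnssUpper (hL : 0 < L) (n : Fin 3 → ℤ)
    {g ψ : Config (m + 1) → ℂ} (hg : Continuous g)
    (hgs : ∀ (σ : Equiv.Perm (Fin (m + 1))) (X : Config (m + 1)), g (X ∘ σ) = g X)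
    (hψ : Continuous ψ)
    (hψs : ∀ (σ : Equiv.Perm (Fin (m + 1))) (X : Config (m + 1)), ψ (X ∘ σ) = ψ X) :
    ((m + 1 : ℕ) : ℂ) * srcPair m L n g ψ =
      ∫ X in cellN (m + 1) L, conj (g X) * lnssUpper m L n ψ X := by
  have hRc : Continuous (rootInv m L ψ) := continuous_rootInv hψ
  have hint : ∀ i ∈ (Finset.univ : Finset (Fin (m + 1))), Integrable
      (fun X => conj (g X) * (cellWave L n (X i) * cellAvg (m + 1) L i (rootInv m L ψ) X))
      ((volume : Measure (Config (m + 1))).restrict (cellN (m + 1) L)) := fun i _ =>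
    integrableOn_cellN ((Complex.continuous_conj.comp hg).mul
      (((continuous_cellWave L n).comp (continuous_apply i)).mul (continuous_cellAvg i hRc))) L
  calc ((m + 1 : ℕ) : ℂ) * srcPair m L n g ψ
      = ∑ i : Fin (m + 1), ∫ X in cellN (m + 1) L, conj (g X) *
          (cellWave L n (X i) * cellAvg (m + 1) L i (rootInv m L ψ) X) := by
        rw [Finset.sum_congr rfl fun i _ => integral_slot_eq_srcPair hL n i hgs hψ hψs,
          Finset.sum_const, Finset.card_univ, Fintype.card_fin, nsmul_eq_mul]
    _ = ∫ X in cellN (m + 1) L, ∑ i : Fin (m + 1), conj (g X) *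
          (cellWave L n (X i) * cellAvg (m + 1) L i (rootInv m L ψ) X) :=
        (integral_finsetSum _ hint).symm
    _ = ∫ X in cellN (m + 1) L, conj (g X) * lnssUpper m L n ψ X := by
        refine integral_congr_ae (Eventually.of_forall fun X => ?_)
        simp only [lnssUpper, Finset.mul_sum]

/-- **Adjointness in one slot**: `∫ conj(ψ) e_n(x_i) P_i R = ∫ conj(P_i^{(n)} ψ) R`. [folklore] -/
theorem integral_slot_eq_inner_fourierAvg (n : Fin 3 → ℤ) (i : Fin (m + 1))
    {ψ R : Config (m + 1) → ℂ} (hψ : Continuous ψ) (hR : Continuous R) :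
    ∫ X in cellN (m + 1) L, conj (ψ X) * (cellWave L n (X i) * cellAvg (m + 1) L i R X) =
      ∫ X in cellN (m + 1) L, conj (fourierAvg m L n i ψ X) * R X := by
  have hc : Continuous fun X : Config (m + 1) => conj (cellWave L n (X i)) * ψ X :=
    ((Complex.continuous_conj.comp (continuous_cellWave L n)).comp (continuous_apply i)).mul hψ
  calc ∫ X in cellN (m + 1) L, conj (ψ X) * (cellWave L n (X i) * cellAvg (m + 1) L i R X)
      = ∫ X in cellN (m + 1) L, conj (conj (cellWave L n (X i)) * ψ X) *
          cellAvg (m + 1) L i R X := by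
        refine integral_congr_ae (Eventually.of_forall fun X => ?_)
        simp only [map_mul, Complex.conj_conj]
        ring
    _ = ∫ X in cellN (m + 1) L,
          conj (cellAvg (m + 1) L i (fun X => conj (cellWave L n (X i)) * ψ X) X) * R X :=
        integral_conj_mul_cellAvg i hc hR
    _ = ∫ X in cellN (m + 1) L, conj (fourierAvg m L n i ψ X) * R X := by
        rw [cellAvg_conj_cellWave_mul]

/-- **(L2, second identity)**: `N σ_n(ψ, g) = ⟨Λ_n ψ, g⟩` for continuous symmetric `ψ`, `g`.
[folklore] -/
theorem natMul_srcPair_eq_inner_lnssLower (hL : 0 < L) (n : Fin 3 → ℤ)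
    {ψ g : Config (m + 1) → ℂ} (hψ : Continuous ψ)
    (hψs : ∀ (σ : Equiv.Perm (Fin (m + 1))) (X : Config (m + 1)), ψ (X ∘ σ) = ψ X)
    (hg : Continuous g)
    (hgs : ∀ (σ : Equiv.Perm (Fin (m + 1))) (X : Config (m + 1)), g (X ∘ σ) = g X) :
    ((m + 1 : ℕ) : ℂ) * srcPair m L n ψ g =
      ∫ X in cellN (m + 1) L, conj (lnssLower m L n ψ X) * g X := by
  have hRc : Continuous (rootInv m L g) := continuous_rootInv hg
  have hint : ∀ i ∈ (Finset.univ : Finset (Fin (m + 1))), Integrable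
      (fun X => conj (fourierAvg m L n i ψ X) * rootInv m L g X)
      ((volume : Measure (Config (m + 1))).restrict (cellN (m + 1) L)) := fun i _ =>
    integrableOn_cellN ((Complex.continuous_conj.comp (continuous_fourierAvg n i hψ)).mul hRc) L
  calc ((m + 1 : ℕ) : ℂ) * srcPair m L n ψ g
      = ∑ i : Fin (m + 1), ∫ X in cellN (m + 1) L, conj (ψ X) *
          (cellWave L n (X i) * cellAvg (m + 1) L i (rootInv m L g) X) := by
        rw [Finset.sum_congr rfl fun i _ => integral_slot_eq_srcPair hL n i hψs hg hgs,
          Finset.sum_const, Finset.card_univ, Fintype.card_fin, nsmul_eq_mul]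
    _ = ∑ i : Fin (m + 1), ∫ X in cellN (m + 1) L,
          conj (fourierAvg m L n i ψ X) * rootInv m L g X :=
        Finset.sum_congr rfl fun i _ => integral_slot_eq_inner_fourierAvg n i hψ hRc
    _ = ∫ X in cellN (m + 1) L, ∑ i : Fin (m + 1),
          conj (fourierAvg m L n i ψ X) * rootInv m L g X := (integral_finsetSum _ hint).symm
    _ = ∫ X in cellN (m + 1) L, conj (∑ i : Fin (m + 1), fourierAvg m L n i ψ X) *
          rootInv m L g X := by
        refine integral_congr_ae (Eventually.of_forall fun X => ?_)
        simp only [map_sum, Finset.sum_mul]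
    _ = ∫ X in cellN (m + 1) L, conj (lnssLower m L n ψ X) * g X :=
        integral_conj_mul_rootInv (continuous_sum_fourierAvg n hψ) hg

/-! ## (L3) `‖Λ_nΨ‖² = n_n(Ψ)` -/

/-- For `i ∉ S`: `Q_S P_i^{(n)} g = 0` (`P_i^{(n)} g` is flat in slot `i`). [folklore] -/
theorem modeProj_fourierAvg_eq_zero (hL : 0 < L) (n : Fin 3 → ℤ) {S : Finset (Fin (m + 1))}
    {i : Fin (m + 1)} (hi : i ∉ S) {g : Config (m + 1) → ℂ} (hg : Continuous g) :
    modeProj (m + 1) L S (fourierAvg m L n i g) = 0 :=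
  modeProj_eq_zero_of_cellAvg_eq hL hi (continuous_fourierAvg n i hg)
    (cellAvg_eq_self_of_update hL (fourierAvg_update n i g))

/-- For `0 ∈ S`... no: for `k ∈ S`, `Q_S h` does not depend on slot `k` (`P_k Q_S = Q_S`). [folklore] -/
theorem modeProj_update_of_mem (hL : 0 < L) {S : Finset (Fin (m + 1))} {k : Fin (m + 1)}
    (hk : k ∈ S) {h : Config (m + 1) → ℂ} (hh : Continuous h) (X : Config (m + 1)) (z : Space) :
    modeProj (m + 1) L S h (Function.update X k z) = modeProj (m + 1) L S h X := by
  have e := cellAvg_modeProj hL S k hh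
  rw [if_pos hk] at e
  rw [← e]
  exact cellAvg_update k _ X z

/-- **Bose symmetry inside `S`**: for `i, j ∈ S` and continuous symmetric `g`,
`Q_S P_i^{(n)} g = Q_S P_j^{(n)} g` (both are flat in slots `i`, `j`, and the transposition `(i j)`
fixes `S` and exchanges them). [folklore] -/
theorem modeProj_fourierAvg_eq (hL : 0 < L) (n : Fin 3 → ℤ) {S : Finset (Fin (m + 1))}
    {i j : Fin (m + 1)} (hi : i ∈ S) (hj : j ∈ S) {g : Config (m + 1) → ℂ} (hg : Continuous g)
    (hgs : ∀ (σ : Equiv.Perm (Fin (m + 1))) (X : Config (m + 1)), g (X ∘ σ) = g X) :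
    modeProj (m + 1) L S (fourierAvg m L n i g) = modeProj (m + 1) L S (fourierAvg m L n j g) := by
  have hcj : Continuous (fourierAvg m L n j g) := continuous_fourierAvg n j hg
  -- invariance of `Q_S P_j^{(n)} g` under the transposition
  have hinv : ∀ X, modeProj (m + 1) L S (fourierAvg m L n j g) (X ∘ Equiv.swap i j) =
      modeProj (m + 1) L S (fourierAvg m L n j g) X := by
    intro X
    rw [Equiv.comp_swap_eq_update, modeProj_update_of_mem hL hi hcj,
      modeProj_update_of_mem hL hj hcj]
  -- covariance: the transposition carries `Q_S P_j^{(n)} g` to `Q_S P_i^{(n)} g`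
  have hS : S.map (Equiv.swap i j).toEmbedding = S := by
    ext k
    rw [Finset.mem_map_equiv, Equiv.symm_swap]
    rcases eq_or_ne k i with rfl | hki
    · rw [Equiv.swap_apply_left]; exact iff_of_true hj hi
    · rcases eq_or_ne k j with rfl | hkj
      · rw [Equiv.swap_apply_right]; exact iff_of_true hi hj
      · rw [Equiv.swap_apply_of_ne_of_ne hki hkj]
  have hh : (fun Y => fourierAvg m L n j g (Y ∘ Equiv.swap i j)) = fourierAvg m L n i g := by
    funext Y
    rw [fourierAvg_comp_perm_of_symm n _ j hgs, Equiv.swap_apply_right]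
  have hcov : ∀ X, modeProj (m + 1) L S (fourierAvg m L n j g) (X ∘ Equiv.swap i j) =
      modeProj (m + 1) L S (fourierAvg m L n i g) X := by
    intro X
    have h := congrFun (modeProj_comp_perm (L := L) (Equiv.swap i j) S hcj) X
    rw [hS, hh] at h
    exact h
  funext X
  rw [← hcov X, hinv X]

/-- `|(|S|^{-1/2} : ℂ)|² = |S|⁻¹`. [folklore] -/
theorem norm_sq_coef (S : Finset (Fin (m + 1))) :
    ‖((Real.sqrt (S.card : ℝ))⁻¹ : ℂ)‖ ^ 2 = (S.card : ℝ)⁻¹ := by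
  rw [norm_inv, Complex.norm_real, Real.norm_eq_abs, inv_pow, sq_abs,
    Real.sq_sqrt (Nat.cast_nonneg _)]

/-- **Per-`S` bookkeeping**: for `S ≠ ∅` and `h = Σ_i P_i^{(n)}ψ`,
`|S|⁻¹ ∫ |Q_S h|² = Σ_{i∈S} ∫ |Q_S P_i^{(n)}ψ|²`. [folklore] -/
theorem inv_card_mul_integral_norm_sq_modeProj (hL : 0 < L) (n : Fin 3 → ℤ)
    {S : Finset (Fin (m + 1))} (hS : S.Nonempty) {ψ : Config (m + 1) → ℂ} (hψ : Continuous ψ)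
    (hψs : ∀ (σ : Equiv.Perm (Fin (m + 1))) (X : Config (m + 1)), ψ (X ∘ σ) = ψ X) :
    ‖((Real.sqrt (S.card : ℝ))⁻¹ : ℂ)‖ ^ 2 * ∫ X in cellN (m + 1) L,
        ‖modeProj (m + 1) L S (fun X => ∑ i, fourierAvg m L n i ψ X) X‖ ^ 2 =
      ∑ i ∈ S, ∫ X in cellN (m + 1) L, ‖modeProj (m + 1) L S (fourierAvg m L n i ψ) X‖ ^ 2 := by
  obtain ⟨i₀, hi₀⟩ := hS
  have hh : ∀ i, Continuous (fourierAvg m L n i ψ) := fun i => continuous_fourierAvg n i hψ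
  have hpt : ∀ (i : Fin (m + 1)) (X : Config (m + 1)),
      modeProj (m + 1) L S (fourierAvg m L n i ψ) X =
        if i ∈ S then modeProj (m + 1) L S (fourierAvg m L n i₀ ψ) X else 0 := by
    intro i X
    split_ifs with hi
    · rw [modeProj_fourierAvg_eq hL n hi hi₀ hψ hψs]
    · rw [modeProj_fourierAvg_eq_zero hL n hi hψ, Pi.zero_apply]
  have hQsum : ∀ X, modeProj (m + 1) L S (fun X => ∑ i, fourierAvg m L n i ψ X) X =
      (S.card : ℂ) * modeProj (m + 1) L S (fourierAvg m L n i₀ ψ) X := by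
    intro X
    rw [modeProj_finset_sum _ (fun i _ => hh i)]
    simp only
    rw [Finset.sum_congr rfl fun i (_ : i ∈ Finset.univ) => hpt i X, Finset.sum_ite_mem,
      Finset.univ_inter, Finset.sum_const, nsmul_eq_mul]
  have hcard : (S.card : ℝ) ≠ 0 := Nat.cast_ne_zero.2 (Finset.card_pos.2 ⟨i₀, hi₀⟩).ne'
  calc ‖((Real.sqrt (S.card : ℝ))⁻¹ : ℂ)‖ ^ 2 * ∫ X in cellN (m + 1) L,
        ‖modeProj (m + 1) L S (fun X => ∑ i, fourierAvg m L n i ψ X) X‖ ^ 2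
      = (S.card : ℝ)⁻¹ * ∫ X in cellN (m + 1) L,
          (S.card : ℝ) ^ 2 * ‖modeProj (m + 1) L S (fourierAvg m L n i₀ ψ) X‖ ^ 2 := by
        rw [norm_sq_coef]
        congr 1
        refine integral_congr_ae (Eventually.of_forall fun X => ?_)
        simp only [hQsum, norm_mul, mul_pow, Complex.norm_natCast]
    _ = (S.card : ℝ) * ∫ X in cellN (m + 1) L,
          ‖modeProj (m + 1) L S (fourierAvg m L n i₀ ψ) X‖ ^ 2 := by
        rw [integral_const_mul, ← mul_assoc, sq, ← mul_assoc, inv_mul_cancel₀ hcard, one_mul]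
    _ = ∑ i ∈ S, ∫ X in cellN (m + 1) L,
          ‖modeProj (m + 1) L S (fourierAvg m L n i₀ ψ) X‖ ^ 2 := by
        rw [Finset.sum_const, nsmul_eq_mul]
    _ = ∑ i ∈ S, ∫ X in cellN (m + 1) L,
          ‖modeProj (m + 1) L S (fourierAvg m L n i ψ) X‖ ^ 2 :=
        Finset.sum_congr rfl fun i hi => by rw [modeProj_fourierAvg_eq hL n hi hi₀ hψ hψs]

/-- **`‖Λ_n ψ‖² = N ‖P_0^{(n)} ψ‖²`** (real Bochner form) for continuous symmetric `ψ`. [folklore] -/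
theorem integral_norm_sq_lnssLower (hL : 0 < L) (n : Fin 3 → ℤ) {ψ : Config (m + 1) → ℂ}
    (hψ : Continuous ψ)
    (hψs : ∀ (σ : Equiv.Perm (Fin (m + 1))) (X : Config (m + 1)), ψ (X ∘ σ) = ψ X) :
    ∫ X in cellN (m + 1) L, ‖lnssLower m L n ψ X‖ ^ 2 =
      (m + 1 : ℝ) * ∫ X in cellN (m + 1) L, ‖fourierAvg m L n 0 ψ X‖ ^ 2 := by
  have hh : ∀ i, Continuous (fourierAvg m L n i ψ) := fun i => continuous_fourierAvg n i hψ
  -- Pythagoras over `S ≠ ∅`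
  have e1 : ∫ X in cellN (m + 1) L, ‖lnssLower m L n ψ X‖ ^ 2 =
      ∑ S ∈ (Finset.univ : Finset (Finset (Fin (m + 1)))).filter (fun S => S.Nonempty),
        ‖((Real.sqrt (S.card : ℝ))⁻¹ : ℂ)‖ ^ 2 * ∫ X in cellN (m + 1) L,
          ‖modeProj (m + 1) L S (fun X => ∑ i, fourierAvg m L n i ψ X) X‖ ^ 2 :=
    integral_norm_sq_sum_modeProj hL _ _ (continuous_sum_fourierAvg n hψ)
  -- re-summation `Σ_{S≠∅} Σ_{i∈S} = Σ_i Σ_S` (the terms `i ∉ S` vanish) and `Σ_S ‖Q_S ·‖² = ‖·‖²`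
  have e3 : ∑ S ∈ (Finset.univ : Finset (Finset (Fin (m + 1)))).filter (fun S => S.Nonempty),
      ∑ i ∈ S, ∫ X in cellN (m + 1) L, ‖modeProj (m + 1) L S (fourierAvg m L n i ψ) X‖ ^ 2 =
        ∑ i : Fin (m + 1), ∫ X in cellN (m + 1) L, ‖fourierAvg m L n i ψ X‖ ^ 2 := by
    calc ∑ S ∈ (Finset.univ : Finset (Finset (Fin (m + 1)))).filter (fun S => S.Nonempty),
          ∑ i ∈ S, ∫ X in cellN (m + 1) L, ‖modeProj (m + 1) L S (fourierAvg m L n i ψ) X‖ ^ 2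
        = ∑ S : Finset (Fin (m + 1)), ∑ i ∈ S,
            ∫ X in cellN (m + 1) L, ‖modeProj (m + 1) L S (fourierAvg m L n i ψ) X‖ ^ 2 :=
          Finset.sum_filter_of_ne fun S _ hne => Finset.nonempty_of_sum_ne_zero hne
      _ = ∑ S : Finset (Fin (m + 1)), ∑ i : Fin (m + 1),
            ∫ X in cellN (m + 1) L, ‖modeProj (m + 1) L S (fourierAvg m L n i ψ) X‖ ^ 2 := by
          refine Finset.sum_congr rfl fun S _ =>
            Finset.sum_subset (Finset.subset_univ S) fun i _ hi => ?_
          rw [modeProj_fourierAvg_eq_zero hL n hi hψ]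
          simp
      _ = ∑ i : Fin (m + 1), ∑ S : Finset (Fin (m + 1)),
            ∫ X in cellN (m + 1) L, ‖modeProj (m + 1) L S (fourierAvg m L n i ψ) X‖ ^ 2 :=
          Finset.sum_comm
      _ = ∑ i : Fin (m + 1), ∫ X in cellN (m + 1) L, ‖fourierAvg m L n i ψ X‖ ^ 2 :=
          Finset.sum_congr rfl fun i _ => sum_integral_norm_sq_modeProj hL (hh i)
  -- Bose symmetry: every slot carries the mass of slot `0`
  have e4 : ∀ i : Fin (m + 1), ∫ X in cellN (m + 1) L, ‖fourierAvg m L n i ψ X‖ ^ 2 =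
      ∫ X in cellN (m + 1) L, ‖fourierAvg m L n 0 ψ X‖ ^ 2 := by
    intro i
    rw [← setIntegral_cellN_comp_perm (Equiv.swap 0 i) (fun X => ‖fourierAvg m L n 0 ψ X‖ ^ 2)]
    refine integral_congr_ae (Eventually.of_forall fun X => ?_)
    simp only [fourierAvg_comp_perm_of_symm n _ 0 hψs, Equiv.swap_apply_left]
  rw [e1, Finset.sum_congr rfl fun S hS =>
      inv_card_mul_integral_norm_sq_modeProj hL n (Finset.mem_filter.1 hS).2 hψ hψs,
    e3, Finset.sum_congr rfl fun i _ => e4 i, Finset.sum_const, Finset.card_univ, Fintype.card_fin,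
    nsmul_eq_mul, Nat.cast_add, Nat.cast_one]

/-- The slice of `P_0^{(n)} ψ` at `X = (x, Y)` is the cell Fourier coefficient of `ψ(·, Y)`. [folklore] -/
theorem fourierAvg_zero_vecCons (hL : 0 < L) (n : Fin 3 → ℤ) (ψ : Config (m + 1) → ℂ)
    (x : Space) (Y : Config m) :
    fourierAvg m L n 0 ψ (Matrix.vecCons x Y) =
      cellFourierCoeff L (fun y => ψ (Matrix.vecCons y Y)) n := by
  rw [cellFourierCoeff_eq_integral hL]
  unfold fourierAvg
  simp only [Matrix.vecCons, Fin.update_cons_zero]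

/-- **(L3)** `‖Λ_n ψ‖² = n_n(ψ)` (`= ⟨ψ, a_n†a_n ψ⟩`, the occupation of the plane wave `φ_n`) for
continuous Bose-symmetric `ψ`. [folklore] -/
theorem mass_lnssLower (hL : 0 < L) (n : Fin 3 → ℤ) {ψ : Config (m + 1) → ℂ} (hψ : Continuous ψ)
    (hψs : ∀ (σ : Equiv.Perm (Fin (m + 1))) (X : Config (m + 1)), ψ (X ∘ σ) = ψ X) :
    mass L (lnssLower m L n ψ) = cellOccupation (m + 1) L (planeWaveMode L n) ψ := by
  have h0 : Continuous (fourierAvg m L n 0 ψ) := continuous_fourierAvg n 0 hψ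
  have hmeas : Measurable fun X : Config (m + 1) => ((‖fourierAvg m L n 0 ψ X‖₊ : ℝ≥0∞)) ^ 2 :=
    (h0.measurable.nnnorm.coe_nnreal_ennreal).pow_const _
  unfold mass
  rw [lintegral_nnnorm_sq_eq _ (continuous_lnssLower n hψ), integral_norm_sq_lnssLower hL n hψ hψs,
    ENNReal.ofReal_mul (by positivity), ← lintegral_nnnorm_sq_eq _ h0,
    show ENNReal.ofReal (m + 1 : ℝ) = ((m + 1 : ℕ) : ℝ≥0∞) by
      rw [← Nat.cast_succ, ENNReal.ofReal_natCast],
    cellOccupation_succ, lintegral_cellN_succ L hmeas]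
  push_cast
  congr 1
  refine lintegral_congr fun Y => ?_
  rw [nnnorm_sq_integral_conj_planeWaveMode_mul hL n (fun x => ψ (Matrix.vecCons x Y))]
  simp only [fourierAvg_zero_vecCons hL]
  rw [lintegral_cell_const, mul_comm]

end Lnss

open Literature.MathematicalPhysics.QuantumManyBody.BoseGas in
/-- **Registered stub `stub_lnssAlgebra`** (line `dyson-dressed-witness` of crux `GDTransfer`,
stmt-AtomisticToContinuum-9482): the LNSS configuration-space algebra `LNSSAlgebra` — for every periodic
trial state `Ψ` and `n ∈ ℤ³`, (L1) `Λ_nΨ`, `Λ_n†Ψ` are directions, (L2) `N σ_n(g, Ψ) = ⟨g, Λ_n†Ψ⟩` and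
`N σ_n(Ψ, g) = ⟨Λ_nΨ, g⟩` for every direction `g`, (L3) `‖Λ_nΨ‖² = n_n(Ψ)`. [folklore]
(arXiv:1211.2778 §2–3; LSSY2005 §1.2 (1.17), App. A) -/
theorem stub_lnssAlgebra : Sig.stub_lnssAlgebra := by
  intro m L hL n Ψ
  have hd : IsDirection m L Ψ.ψ := isDirection_trialState Ψ
  refine ⟨Lnss.isDirection_lnssLower n hd, Lnss.isDirection_lnssUpper hL.ne' n hd,
    fun g hg => ⟨?_, ?_⟩, ?_⟩
  · exact Lnss.natMul_srcPair_eq_inner_lnssUpper hL n hg.contDiff.continuous hg.symm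
      Ψ.contDiff.continuous Ψ.symm
  · exact Lnss.natMul_srcPair_eq_inner_lnssLower hL n Ψ.contDiff.continuous Ψ.symm
      hg.contDiff.continuous hg.symm
  · exact Lnss.mass_lnssLower hL n Ψ.contDiff.continuous Ψ.symm

end Summit.AtomisticToContinuum.BoseEinsteinCondensation.Cruxes.GDTransfer.DysonDressedWitness

end
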